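import Literature.Analysis.ODE.TorusFlowFrameRegularity
import Literature.Analysis.ODE.LiouvilleFormula
import HarnessLib

/-!
# The inverse frame `G = (∇X)⁻¹` of the flow of a divergence-free field continuous in time:
# `det ∇X ≡ 1`, `G = adj ∇X`, `∂ₛG = −G · ∇b(s, X)` and the frame-rate bound

Analysis/ODE proof file (theorems only; no definitions, no named facts). Continuation of
`TorusFlowFrameRegularity` (FR1–FR4 for `J = 1 + ∇D`) under the additional hypothesis that the
velocity slices are divergence free. With the same hypotheses (space–time lifts of `b, D` continuous
on `[0,T] × ℝ^d`, smooth slices, time-uniform derivative bounds, the integral flow equation) and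
`div b(t,·) = 0`:
* §1 **Liouville for `t`-continuous fields**: `det J(s,x) = 1` on `[0,T]` (`det_flowJac_eq_one`):
  Jacobi's formula within `[0,T]` (`hasDerivWithinAt_det_rows`, `sum_det_updateRow_mul_eq`) gives
  `∂ₛ det J = (div b)(s,X) det J = 0`, and `J(0) = 1`;
* §2 `J · adj J = adj J · J = 1`, `J⁻¹ = adj J` (`flowJac_mul_adjugate`, `inv_flowJac_eq_adjugate`);
* §3 **the frame equation**: every entry of `G := adj J = J⁻¹` is differentiable within `[0,T]` with
  `∂ₛ G(s,x) = −G(s,x) · ∇b(s, X(s,x))`, `(∇b)_{jc} = ∂_c b_j` (`hasDerivWithinAt_adjugate_flowJac_entry`) —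
  from `∂ₛJ = ∇b·J` (FR4), `J G = 1` and uniqueness of derivatives within `[0,T]`;
* §4 **frame bounds and the frame RATE**: `|G_{ij}| ≤ d!(1 + C_D¹)^d`, `|∂ₛG_{ij}| ≤ d·d!(1 + C_D¹)^d·C_b¹`
  (`abs_adjugate_flowJac_le`, `abs_frameRate_le`) and the Lipschitz bound in time
  (`lipschitzOnWith_adjugate_flowJac_entry`) — the hypothesis `|∂ₛ frameG| ≤ α` of the cell's W3a.

## References

* A. J. Majda, A. L. Bertozzi, *Vorticity and Incompressible Flow* (CUP 2002), §1.3 Prop. 1.2 and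
  Prop. 1.4 (`∂ₜJ = (div v)|_X J`; incompressible ⇔ `J ≡ 1`), §4.1. [`MajdaBertozziCUP2002`]
* P. Hartman, *Ordinary Differential Equations*, 2nd ed., SIAM 2002, Ch. IV §1 (Liouville's formula
  for linear systems with continuous coefficients), Ch. V Thm. 3.1. [`Hartman2002`]
-/

noncomputable section

open Set Filter Topology Function Matrix
open scoped NNReal

namespace Literature.Analysis.ODE

namespace TorusFlow

open Literature.Analysis.FunctionSpaces Literature.Analysis.FunctionSpaces.Torus Literature.Analysis.Calculus

variable {d : Type*} [Fintype d] [DecidableEq d]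
variable {b D : ℝ → UnitAddTorus d → EuclideanSpace ℝ d} {T : ℝ}

/-! ## §1 Liouville: `det J ≡ 1` on the window -/

/-- The curve of Jacobian matrices `u ↦ J(u,x)` (as `d → d → ℝ`) has, within `[0,T]`, the derivative
`∇b(s, X(s,x)) · J(s,x)` (FR4, all entries at once). [cite: MajdaBertozziCUP2002, §4.1] -/
theorem hasDerivWithinAt_flowJac_rows (hbc : ContinuousOn (stLift b) (Icc 0 T ×ˢ univ))
    (hbs : ∀ t ∈ Icc 0 T, IsSmooth (b t))
    (hbB : ∀ n : ℕ, ∃ C : ℝ, ∀ t ∈ Icc 0 T, ∀ y, ‖iteratedFDeriv ℝ n (lift (b t)) y‖ ≤ C)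
    (hDc : ContinuousOn (stLift D) (Icc 0 T ×ˢ univ)) (hDs : ∀ t ∈ Icc 0 T, IsSmooth (D t))
    (hDB : ∀ n : ℕ, ∃ C : ℝ, ∀ t ∈ Icc 0 T, ∀ y, ‖iteratedFDeriv ℝ n (lift (D t)) y‖ ≤ C)
    (hint : ∀ s ∈ Icc 0 T, ∀ x, D s x = ∫ r in (0 : ℝ)..s, b r (x + proj (D r x)))
    {s : ℝ} (hs : s ∈ Icc 0 T) (x : UnitAddTorus d) :
    HasDerivWithinAt (fun u : ℝ => fun a c : d => (1 : Matrix d d ℝ) a c + partialDeriv c (fun z => D u z a) x)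
      (fun a => ((Matrix.of fun a k => partialDeriv k (fun z => b s z a) (x + proj (D s x))) *
        Matrix.of (fun a c => (1 : Matrix d d ℝ) a c + partialDeriv c (fun z => D s z a) x)) a) (Icc 0 T) s := by
  refine hasDerivWithinAt_pi.2 fun a => hasDerivWithinAt_pi.2 fun c => ?_
  refine (hasDerivWithinAt_flowJac_entry hbc hbs hbB hDc hDs hDB hint hs x a c).congr_deriv ?_
  simp only [Matrix.mul_apply, Matrix.of_apply]

/-- **Jacobi's formula within the window**: `∂ₛ det J(s,x) = (div b)(s, X(s,x)) · det J(s,x)` for the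
flow of a field continuous in time and smooth in space. [cite: MajdaBertozziCUP2002, §1.3 Prop. 1.2 (proof, (1.15))] -/
theorem hasDerivWithinAt_det_flowJac (hbc : ContinuousOn (stLift b) (Icc 0 T ×ˢ univ))
    (hbs : ∀ t ∈ Icc 0 T, IsSmooth (b t))
    (hbB : ∀ n : ℕ, ∃ C : ℝ, ∀ t ∈ Icc 0 T, ∀ y, ‖iteratedFDeriv ℝ n (lift (b t)) y‖ ≤ C)
    (hDc : ContinuousOn (stLift D) (Icc 0 T ×ˢ univ)) (hDs : ∀ t ∈ Icc 0 T, IsSmooth (D t))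
    (hDB : ∀ n : ℕ, ∃ C : ℝ, ∀ t ∈ Icc 0 T, ∀ y, ‖iteratedFDeriv ℝ n (lift (D t)) y‖ ≤ C)
    (hint : ∀ s ∈ Icc 0 T, ∀ x, D s x = ∫ r in (0 : ℝ)..s, b r (x + proj (D r x)))
    {s : ℝ} (hs : s ∈ Icc 0 T) (x : UnitAddTorus d) :
    HasDerivWithinAt
      (fun u => (Matrix.of fun a c => (1 : Matrix d d ℝ) a c + partialDeriv c (fun z => D u z a) x).det)
      (divergence (b s) (x + proj (D s x)) *
        (Matrix.of fun a c => (1 : Matrix d d ℝ) a c + partialDeriv c (fun z => D s z a) x).det) (Icc 0 T) s := by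
  set m : ℝ → d → d → ℝ := fun u a c => (1 : Matrix d d ℝ) a c + partialDeriv c (fun z => D u z a) x with hm
  set B : Matrix d d ℝ := Matrix.of fun a k => partialDeriv k (fun z => b s z a) (x + proj (D s x)) with hB
  have hm' : HasDerivWithinAt m (fun a => (B * Matrix.of (m s)) a) (Icc 0 T) s :=
    hasDerivWithinAt_flowJac_rows hbc hbs hbB hDc hDs hDB hint hs x
  have hdet := hasDerivWithinAt_det_rows hm'
  have hsum : ∑ j, (Matrix.of (update (m s) j ((B * Matrix.of (m s)) j))).det =
      (Matrix.of (m s)).det * B.trace := sum_det_updateRow_mul_eq (Matrix.of (m s)) B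
  rw [hsum] at hdet
  have htr : B.trace = divergence (b s) (x + proj (D s x)) := by
    simp only [Matrix.trace, Matrix.diag_apply, hB, Matrix.of_apply, divergence]
  rw [htr, mul_comm] at hdet
  exact hdet

/-- **Liouville's theorem for `t`-continuous divergence-free fields**: on the window, `det J(s,x) = 1`.
[cite: MajdaBertozziCUP2002, §1.3 Prop. 1.4 ((ii) ⇒ (iii)); Hartman2002, Ch. IV §1 (Liouville's formula)] -/
theorem det_flowJac_eq_one (hbc : ContinuousOn (stLift b) (Icc 0 T ×ˢ univ))
    (hbs : ∀ t ∈ Icc 0 T, IsSmooth (b t))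
    (hbB : ∀ n : ℕ, ∃ C : ℝ, ∀ t ∈ Icc 0 T, ∀ y, ‖iteratedFDeriv ℝ n (lift (b t)) y‖ ≤ C)
    (hDc : ContinuousOn (stLift D) (Icc 0 T ×ˢ univ)) (hDs : ∀ t ∈ Icc 0 T, IsSmooth (D t))
    (hDB : ∀ n : ℕ, ∃ C : ℝ, ∀ t ∈ Icc 0 T, ∀ y, ‖iteratedFDeriv ℝ n (lift (D t)) y‖ ≤ C)
    (hint : ∀ s ∈ Icc 0 T, ∀ x, D s x = ∫ r in (0 : ℝ)..s, b r (x + proj (D r x)))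
    (hdiv : ∀ t ∈ Icc 0 T, IsDivFree (b t)) {s : ℝ} (hs : s ∈ Icc 0 T) (x : UnitAddTorus d) :
    (Matrix.of fun a c => (1 : Matrix d d ℝ) a c + partialDeriv c (fun z => D s z a) x).det = 1 := by
  set F : ℝ → ℝ := fun u =>
    (Matrix.of fun a c => (1 : Matrix d d ℝ) a c + partialDeriv c (fun z => D u z a) x).det with hF
  have hF' : ∀ u ∈ Icc 0 T, HasDerivWithinAt F 0 (Icc 0 T) u := by
    intro u hu
    have h := hasDerivWithinAt_det_flowJac hbc hbs hbB hDc hDs hDB hint hu x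
    rw [hdiv u hu _, zero_mul] at h
    exact h
  have hcont : ContinuousOn F (Icc 0 T) := fun u hu => (hF' u hu).continuousWithinAt
  have hconst := constant_of_has_deriv_right_zero hcont (fun u hu =>
    (hF' u (Ico_subset_Icc_self hu)).mono_of_mem_nhdsWithin
      (mem_of_superset (Icc_mem_nhdsGE hu.2) (Icc_subset_Icc_left hu.1))) s hs
  have h0T : (0 : ℝ) ∈ Icc 0 T := ⟨le_rfl, hs.1.trans hs.2⟩
  have hD0 : ∀ y, D 0 y = 0 := fun y => by rw [hint 0 h0T y, intervalIntegral.integral_same]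
  have hF0 : F 0 = 1 := by
    have hzero : ∀ a c, partialDeriv c (fun z => D 0 z a) x = 0 := by
      intro a c
      rw [show (fun z => D 0 z a) = fun _ => (0 : ℝ) from funext fun z => by rw [hD0 z]; rfl]
      simp [partialDeriv, Torus.lineDeriv]
    simp only [hF, hzero, add_zero]
    rw [show (Matrix.of fun a c => (1 : Matrix d d ℝ) a c) = 1 from rfl, Matrix.det_one]
  show F s = 1
  rw [hconst, hF0]

/-! ## §2 `G = adj J = J⁻¹` -/

/-- `J · adj J = 1` on the window. [cite: MajdaBertozziCUP2002, §1.3 Prop. 1.4] -/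
theorem flowJac_mul_adjugate (hbc : ContinuousOn (stLift b) (Icc 0 T ×ˢ univ))
    (hbs : ∀ t ∈ Icc 0 T, IsSmooth (b t))
    (hbB : ∀ n : ℕ, ∃ C : ℝ, ∀ t ∈ Icc 0 T, ∀ y, ‖iteratedFDeriv ℝ n (lift (b t)) y‖ ≤ C)
    (hDc : ContinuousOn (stLift D) (Icc 0 T ×ˢ univ)) (hDs : ∀ t ∈ Icc 0 T, IsSmooth (D t))
    (hDB : ∀ n : ℕ, ∃ C : ℝ, ∀ t ∈ Icc 0 T, ∀ y, ‖iteratedFDeriv ℝ n (lift (D t)) y‖ ≤ C)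
    (hint : ∀ s ∈ Icc 0 T, ∀ x, D s x = ∫ r in (0 : ℝ)..s, b r (x + proj (D r x)))
    (hdiv : ∀ t ∈ Icc 0 T, IsDivFree (b t)) {s : ℝ} (hs : s ∈ Icc 0 T) (x : UnitAddTorus d) :
    (Matrix.of fun a c => (1 : Matrix d d ℝ) a c + partialDeriv c (fun z => D s z a) x) *
      (Matrix.of fun a c => (1 : Matrix d d ℝ) a c + partialDeriv c (fun z => D s z a) x).adjugate = 1 := by
  rw [Matrix.mul_adjugate, det_flowJac_eq_one hbc hbs hbB hDc hDs hDB hint hdiv hs x, one_smul]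

/-- `adj J · J = 1` on the window. [cite: MajdaBertozziCUP2002, §1.3 Prop. 1.4] -/
theorem adjugate_mul_flowJac (hbc : ContinuousOn (stLift b) (Icc 0 T ×ˢ univ))
    (hbs : ∀ t ∈ Icc 0 T, IsSmooth (b t))
    (hbB : ∀ n : ℕ, ∃ C : ℝ, ∀ t ∈ Icc 0 T, ∀ y, ‖iteratedFDeriv ℝ n (lift (b t)) y‖ ≤ C)
    (hDc : ContinuousOn (stLift D) (Icc 0 T ×ˢ univ)) (hDs : ∀ t ∈ Icc 0 T, IsSmooth (D t))
    (hDB : ∀ n : ℕ, ∃ C : ℝ, ∀ t ∈ Icc 0 T, ∀ y, ‖iteratedFDeriv ℝ n (lift (D t)) y‖ ≤ C)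
    (hint : ∀ s ∈ Icc 0 T, ∀ x, D s x = ∫ r in (0 : ℝ)..s, b r (x + proj (D r x)))
    (hdiv : ∀ t ∈ Icc 0 T, IsDivFree (b t)) {s : ℝ} (hs : s ∈ Icc 0 T) (x : UnitAddTorus d) :
    (Matrix.of fun a c => (1 : Matrix d d ℝ) a c + partialDeriv c (fun z => D s z a) x).adjugate *
      (Matrix.of fun a c => (1 : Matrix d d ℝ) a c + partialDeriv c (fun z => D s z a) x) = 1 := by
  rw [Matrix.adjugate_mul, det_flowJac_eq_one hbc hbs hbB hDc hDs hDB hint hdiv hs x, one_smul]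

/-- `J⁻¹ = adj J` on the window (the distortion field `frameG` of the cell is the adjugate).
[cite: MajdaBertozziCUP2002, §1.3 Prop. 1.4] -/
theorem inv_flowJac_eq_adjugate (hbc : ContinuousOn (stLift b) (Icc 0 T ×ˢ univ))
    (hbs : ∀ t ∈ Icc 0 T, IsSmooth (b t))
    (hbB : ∀ n : ℕ, ∃ C : ℝ, ∀ t ∈ Icc 0 T, ∀ y, ‖iteratedFDeriv ℝ n (lift (b t)) y‖ ≤ C)
    (hDc : ContinuousOn (stLift D) (Icc 0 T ×ˢ univ)) (hDs : ∀ t ∈ Icc 0 T, IsSmooth (D t))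
    (hDB : ∀ n : ℕ, ∃ C : ℝ, ∀ t ∈ Icc 0 T, ∀ y, ‖iteratedFDeriv ℝ n (lift (D t)) y‖ ≤ C)
    (hint : ∀ s ∈ Icc 0 T, ∀ x, D s x = ∫ r in (0 : ℝ)..s, b r (x + proj (D r x)))
    (hdiv : ∀ t ∈ Icc 0 T, IsDivFree (b t)) {s : ℝ} (hs : s ∈ Icc 0 T) (x : UnitAddTorus d) :
    (Matrix.of fun a c => (1 : Matrix d d ℝ) a c + partialDeriv c (fun z => D s z a) x)⁻¹ =
      (Matrix.of fun a c => (1 : Matrix d d ℝ) a c + partialDeriv c (fun z => D s z a) x).adjugate := by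
  rw [Matrix.inv_def, det_flowJac_eq_one hbc hbs hbB hDc hDs hDB hint hdiv hs x, Ring.inverse_one, one_smul]

/-! ## §3 The frame equation `∂ₛG = −G · ∇b(s, X)` -/

/-- Adjugate entries of a curve of matrices differentiable within a set are differentiable within
that set (an adjugate entry is the determinant of the matrix with one row replaced by a constant
row). [folklore] -/
private theorem exists_hasDerivWithinAt_adjugate {m : ℝ → d → d → ℝ} {m' : d → d → ℝ} {S : Set ℝ} {s : ℝ}
    (hm : HasDerivWithinAt m m' S s) (i j : d) :
    ∃ A' : ℝ, HasDerivWithinAt (fun u => (Matrix.of (m u)).adjugate i j) A' S s := by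
  have hrow : HasDerivWithinAt (fun u => update (m u) j (Pi.single i (1 : ℝ))) (update m' j 0) S s := by
    refine hasDerivWithinAt_pi.2 fun a => ?_
    by_cases ha : a = j
    · subst ha
      simp only [update_self]
      exact hasDerivWithinAt_const _ _ _
    · simp only [update_of_ne ha]
      exact hasDerivWithinAt_pi.1 hm a
  have key : ∀ u, (Matrix.of (m u)).adjugate i j = (Matrix.of (update (m u) j (Pi.single i (1 : ℝ)))).det :=
    fun u => Matrix.adjugate_apply _ _ _
  exact ⟨_, (hasDerivWithinAt_det_rows hrow).congr (fun u _ => key u) (key s)⟩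

/-- **The frame equation.** Every entry of the inverse frame `G(s,x) = adj J(s,x) = J(s,x)⁻¹` is
differentiable within `[0,T]` (for `T > 0`) with
`∂ₛ G(s,x)_{ij} = −(G(s,x) · ∇b(s, X(s,x)))_{ij} = −Σₖ G_{ik} ∂ⱼb_k(s, X(s,x))`
(from `∂ₛJ = ∇b·J`, `J G = G J = 1` and uniqueness of one-sided derivatives).
[cite: MajdaBertozziCUP2002, §4.1 (equations for ∇X and its inverse along trajectories); Hartman2002, Ch. IV §1] -/
theorem hasDerivWithinAt_adjugate_flowJac_entry (hT : 0 < T) (hbc : ContinuousOn (stLift b) (Icc 0 T ×ˢ univ))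
    (hbs : ∀ t ∈ Icc 0 T, IsSmooth (b t))
    (hbB : ∀ n : ℕ, ∃ C : ℝ, ∀ t ∈ Icc 0 T, ∀ y, ‖iteratedFDeriv ℝ n (lift (b t)) y‖ ≤ C)
    (hDc : ContinuousOn (stLift D) (Icc 0 T ×ˢ univ)) (hDs : ∀ t ∈ Icc 0 T, IsSmooth (D t))
    (hDB : ∀ n : ℕ, ∃ C : ℝ, ∀ t ∈ Icc 0 T, ∀ y, ‖iteratedFDeriv ℝ n (lift (D t)) y‖ ≤ C)
    (hint : ∀ s ∈ Icc 0 T, ∀ x, D s x = ∫ r in (0 : ℝ)..s, b r (x + proj (D r x)))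
    (hdiv : ∀ t ∈ Icc 0 T, IsDivFree (b t)) {s : ℝ} (hs : s ∈ Icc 0 T) (x : UnitAddTorus d) (i j : d) :
    HasDerivWithinAt
      (fun u => (Matrix.of fun a c => (1 : Matrix d d ℝ) a c + partialDeriv c (fun z => D u z a) x).adjugate i j)
      (-((Matrix.of fun a c => (1 : Matrix d d ℝ) a c + partialDeriv c (fun z => D s z a) x).adjugate *
          (Matrix.of fun a k => partialDeriv k (fun z => b s z a) (x + proj (D s x)))) i j) (Icc 0 T) s := by
  set m : ℝ → d → d → ℝ := fun u a c => (1 : Matrix d d ℝ) a c + partialDeriv c (fun z => D u z a) x with hm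
  set B : Matrix d d ℝ := Matrix.of fun a k => partialDeriv k (fun z => b s z a) (x + proj (D s x)) with hB
  set J : Matrix d d ℝ := Matrix.of (m s) with hJ
  set G : Matrix d d ℝ := J.adjugate with hG
  have hm' : HasDerivWithinAt m (fun a => (B * J) a) (Icc 0 T) s :=
    hasDerivWithinAt_flowJac_rows hbc hbs hbB hDc hDs hDB hint hs x
  -- some derivative of every adjugate entry
  have hA : ∀ k c, ∃ A' : ℝ, HasDerivWithinAt (fun u => (Matrix.of (m u)).adjugate k c) A' (Icc 0 T) s :=
    fun k c => exists_hasDerivWithinAt_adjugate hm' k c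
  choose A' hA' using hA
  -- differentiate `J G = 1` entrywise within `[0,T]`
  have hJG : ∀ u ∈ Icc 0 T, Matrix.of (m u) * (Matrix.of (m u)).adjugate = 1 := fun u hu =>
    flowJac_mul_adjugate hbc hbs hbB hDc hDs hDB hint hdiv hu x
  have hzero : ∀ a c, ∑ k, ((B * J) a k * G k c + J a k * A' k c) = 0 := by
    intro a c
    have hprod : HasDerivWithinAt (fun u => ∑ k, m u a k * (Matrix.of (m u)).adjugate k c)
        (∑ k, ((B * J) a k * G k c + J a k * A' k c)) (Icc 0 T) s := by
      refine HasDerivWithinAt.fun_sum fun k _ => ?_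
      have h1 : HasDerivWithinAt (fun u => m u a k) ((B * J) a k) (Icc 0 T) s :=
        hasDerivWithinAt_pi.1 (hasDerivWithinAt_pi.1 hm' a) k
      have h := h1.mul (hA' k c)
      exact h.congr_deriv rfl
    have hconst : HasDerivWithinAt (fun u => ∑ k, m u a k * (Matrix.of (m u)).adjugate k c)
        0 (Icc 0 T) s := by
      refine (hasDerivWithinAt_const s (Icc 0 T) ((1 : Matrix d d ℝ) a c)).congr (fun u hu => ?_) ?_
      · have h := congrFun (congrFun (hJG u hu) a) c
        rw [Matrix.mul_apply] at h
        exact h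
      · have h := congrFun (congrFun (hJG s hs) a) c
        rw [Matrix.mul_apply] at h
        exact h
    exact (uniqueDiffOn_Icc hT s hs).eq_deriv _ hprod hconst
  -- solve for `A'`: `A' = −G B` (using `G J = 1`, `J G = 1`)
  have hGJ : G * J = 1 := adjugate_mul_flowJac hbc hbs hbB hDc hDs hDB hint hdiv hs x
  have hmat : B * J * G + J * Matrix.of A' = 0 := by
    ext a c
    rw [Matrix.add_apply, Matrix.mul_apply, Matrix.mul_apply, Matrix.zero_apply, ← hzero a c,
      ← Finset.sum_add_distrib]
    rfl
  have hA'eq : Matrix.of A' = -(G * B) := by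
    have h1 : G * (B * J * G + J * Matrix.of A') = 0 := by rw [hmat, Matrix.mul_zero]
    have e2 : G * (J * Matrix.of A') = Matrix.of A' := by rw [← Matrix.mul_assoc, hGJ, Matrix.one_mul]
    have e3 : G * (B * J * G) = G * B := by
      rw [Matrix.mul_assoc B J G, show J * G = 1 from hJG s hs, Matrix.mul_one]
    rw [Matrix.mul_add, e2, e3] at h1
    exact eq_neg_of_add_eq_zero_right h1
  have hij : A' i j = -((G * B) i j) := by
    have := congrFun (congrFun hA'eq i) j
    simpa only [Matrix.of_apply, Matrix.neg_apply] using this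
  show HasDerivWithinAt (fun u => (Matrix.of (m u)).adjugate i j) (-((G * B) i j)) (Icc 0 T) s
  rw [← hij]
  exact hA' i j

/-! ## §4 Frame bounds, the frame rate, and Lipschitz continuity in time -/

omit [DecidableEq d] in
/-- A component of a partial derivative is bounded by the first-order lift bound. [folklore] -/
private theorem abs_partialDeriv_apply_le' [DecidableEq d] {u : UnitAddTorus d → EuclideanSpace ℝ d}
    (hu : IsSmooth u) {C : ℝ} (h : ∀ y, ‖iteratedFDeriv ℝ 1 (lift u) y‖ ≤ C) (j a : d) (x : UnitAddTorus d) :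
    |partialDeriv j (fun z => u z a) x| ≤ C := by
  obtain ⟨y, rfl⟩ := proj_surjective x
  have h1 : IsContDiff 1 u := hu.isContDiff (by simp)
  rw [partialDeriv_apply_coord h1]
  have e1 : partialDeriv j u (proj y) = _root_.fderiv ℝ (lift u) y (EuclideanSpace.single j (1 : ℝ)) :=
    congrFun (lift_lineDeriv h1 (EuclideanSpace.single j (1 : ℝ))) y
  calc |partialDeriv j u (proj y) a| = ‖partialDeriv j u (proj y) a‖ := (Real.norm_eq_abs _).symm
    _ ≤ ‖partialDeriv j u (proj y)‖ := PiLp.norm_apply_le _ a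
    _ = ‖_root_.fderiv ℝ (lift u) y (EuclideanSpace.single j (1 : ℝ))‖ := by rw [e1]
    _ ≤ ‖_root_.fderiv ℝ (lift u) y‖ * ‖(EuclideanSpace.single j (1 : ℝ) : EuclideanSpace ℝ d)‖ :=
        ContinuousLinearMap.le_opNorm _ _
    _ ≤ C * 1 := by
        rw [show ‖(EuclideanSpace.single j (1 : ℝ) : EuclideanSpace ℝ d)‖ = 1 by simp, ← norm_iteratedFDeriv_one]
        exact mul_le_mul_of_nonneg_right (h y) zero_le_one
    _ = C := mul_one C

/-- **Bound on the inverse frame**: with `|∂_c D_a| ≤ C_D` (first-order lift bound) every entry of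
`G = adj J` satisfies `|G_{ij}| ≤ d! (1 + C_D)^d`. [cite: MajdaBertozziCUP2002, §4.1 (bounds on ∇X⁻¹ from bounds on ∇X)] -/
theorem abs_adjugate_flowJac_le (hDs : ∀ t ∈ Icc 0 T, IsSmooth (D t)) {CD : ℝ}
    (hCD : ∀ t ∈ Icc 0 T, ∀ y, ‖iteratedFDeriv ℝ 1 (lift (D t)) y‖ ≤ CD)
    {s : ℝ} (hs : s ∈ Icc 0 T) (x : UnitAddTorus d) (i j : d) :
    |(Matrix.of fun a c => (1 : Matrix d d ℝ) a c + partialDeriv c (fun z => D s z a) x).adjugate i j| ≤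
      (Nat.factorial (Fintype.card d) : ℝ) * (1 + CD) ^ Fintype.card d := by
  have hCD0 : 0 ≤ CD := (norm_nonneg _).trans (hCD s hs 0)
  rw [Matrix.adjugate_apply]
  have hentry : ∀ a c, |((Matrix.of fun a c => (1 : Matrix d d ℝ) a c + partialDeriv c (fun z => D s z a) x).updateRow
      j (Pi.single i 1)) a c| ≤ 1 + CD := by
    intro a c
    rw [Matrix.updateRow_apply]
    split_ifs with h
    · rw [Pi.single_apply]
      split_ifs
      · rw [abs_one]; linarith
      · rw [abs_zero]; linarith
    · rw [Matrix.of_apply]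
      calc |(1 : Matrix d d ℝ) a c + partialDeriv c (fun z => D s z a) x|
          ≤ |(1 : Matrix d d ℝ) a c| + |partialDeriv c (fun z => D s z a) x| := abs_add_le _ _
        _ ≤ 1 + CD := add_le_add (by rw [Matrix.one_apply]; split_ifs <;> simp)
            (abs_partialDeriv_apply_le' (hDs s hs) (hCD s hs) c a x)
  set N := (Matrix.of fun a c => (1 : Matrix d d ℝ) a c + partialDeriv c (fun z => D s z a) x).updateRow
      j (Pi.single i 1) with hN
  rw [Matrix.det_apply']
  have hsign : ∀ σ : Equiv.Perm d, |((Equiv.Perm.sign σ : ℤ) : ℝ)| = 1 := fun σ => by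
    rcases Int.units_eq_one_or (Equiv.Perm.sign σ) with h | h <;> simp [h]
  calc |∑ σ : Equiv.Perm d, ((Equiv.Perm.sign σ : ℤ) : ℝ) * ∏ a, N (σ a) a|
      ≤ ∑ σ : Equiv.Perm d, |((Equiv.Perm.sign σ : ℤ) : ℝ) * ∏ a, N (σ a) a| := Finset.abs_sum_le_sum_abs _ _
    _ = ∑ σ : Equiv.Perm d, ∏ a, |N (σ a) a| := Finset.sum_congr rfl fun σ _ => by
        rw [abs_mul, hsign, one_mul, Finset.abs_prod]
    _ ≤ ∑ _σ : Equiv.Perm d, ∏ _a : d, (1 + CD) := Finset.sum_le_sum fun σ _ =>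
        Finset.prod_le_prod (fun a _ => abs_nonneg _) fun a _ => hentry (σ a) a
    _ = (Nat.factorial (Fintype.card d) : ℝ) * (1 + CD) ^ Fintype.card d := by
        rw [Finset.prod_const, Finset.card_univ, Finset.sum_const, Finset.card_univ, Fintype.card_perm,
          nsmul_eq_mul]

/-- **The frame RATE**: `|∂ₛG_{ij}| = |(G · ∇b(s,X))_{ij}| ≤ d · d!(1 + C_D)^d · C_b` on the window —
the constant `α` of the cell's frame-rate hypothesis `|∂ₛ frameG| ≤ α`, from the first-order bounds
of the level data. [cite: MajdaBertozziCUP2002, §4.1] -/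
theorem abs_frameRate_le (hbs : ∀ t ∈ Icc 0 T, IsSmooth (b t)) {Cb : ℝ}
    (hCb : ∀ t ∈ Icc 0 T, ∀ y, ‖iteratedFDeriv ℝ 1 (lift (b t)) y‖ ≤ Cb)
    (hDs : ∀ t ∈ Icc 0 T, IsSmooth (D t)) {CD : ℝ}
    (hCD : ∀ t ∈ Icc 0 T, ∀ y, ‖iteratedFDeriv ℝ 1 (lift (D t)) y‖ ≤ CD)
    {s : ℝ} (hs : s ∈ Icc 0 T) (x : UnitAddTorus d) (i j : d) :
    |((Matrix.of fun a c => (1 : Matrix d d ℝ) a c + partialDeriv c (fun z => D s z a) x).adjugate *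
        (Matrix.of fun a k => partialDeriv k (fun z => b s z a) (x + proj (D s x)))) i j| ≤
      (Fintype.card d : ℝ) * ((Nat.factorial (Fintype.card d) : ℝ) * (1 + CD) ^ Fintype.card d) * Cb := by
  have hCD0 : 0 ≤ CD := (norm_nonneg _).trans (hCD s hs 0)
  have hfac : 0 ≤ (Nat.factorial (Fintype.card d) : ℝ) * (1 + CD) ^ Fintype.card d :=
    mul_nonneg (Nat.cast_nonneg _) (pow_nonneg (by linarith) _)
  rw [Matrix.mul_apply]
  calc |∑ k, (Matrix.of fun a c => (1 : Matrix d d ℝ) a c + partialDeriv c (fun z => D s z a) x).adjugate i k *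
        (Matrix.of fun a k => partialDeriv k (fun z => b s z a) (x + proj (D s x))) k j|
      ≤ ∑ k, |(Matrix.of fun a c => (1 : Matrix d d ℝ) a c + partialDeriv c (fun z => D s z a) x).adjugate i k *
        (Matrix.of fun a k => partialDeriv k (fun z => b s z a) (x + proj (D s x))) k j| :=
        Finset.abs_sum_le_sum_abs _ _
    _ ≤ ∑ _k : d, ((Nat.factorial (Fintype.card d) : ℝ) * (1 + CD) ^ Fintype.card d) * Cb :=
        Finset.sum_le_sum fun k _ => by
          rw [abs_mul, Matrix.of_apply]
          exact mul_le_mul (abs_adjugate_flowJac_le hDs hCD hs x i k)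
            (abs_partialDeriv_apply_le' (hbs s hs) (hCb s hs) j k _) (abs_nonneg _) hfac
    _ = (Fintype.card d : ℝ) * ((Nat.factorial (Fintype.card d) : ℝ) * (1 + CD) ^ Fintype.card d) * Cb := by
        rw [Finset.sum_const, Finset.card_univ, nsmul_eq_mul]; ring

/-- **Lipschitz continuity of the inverse frame in time**, uniformly in the label and the indices.
[cite: MajdaBertozziCUP2002, §4.1] -/
theorem lipschitzOnWith_adjugate_flowJac_entry (hT : 0 < T) (hbc : ContinuousOn (stLift b) (Icc 0 T ×ˢ univ))
    (hbs : ∀ t ∈ Icc 0 T, IsSmooth (b t))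
    (hbB : ∀ n : ℕ, ∃ C : ℝ, ∀ t ∈ Icc 0 T, ∀ y, ‖iteratedFDeriv ℝ n (lift (b t)) y‖ ≤ C)
    (hDc : ContinuousOn (stLift D) (Icc 0 T ×ˢ univ)) (hDs : ∀ t ∈ Icc 0 T, IsSmooth (D t))
    (hDB : ∀ n : ℕ, ∃ C : ℝ, ∀ t ∈ Icc 0 T, ∀ y, ‖iteratedFDeriv ℝ n (lift (D t)) y‖ ≤ C)
    (hint : ∀ s ∈ Icc 0 T, ∀ x, D s x = ∫ r in (0 : ℝ)..s, b r (x + proj (D r x)))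
    (hdiv : ∀ t ∈ Icc 0 T, IsDivFree (b t)) :
    ∃ K : ℝ≥0, ∀ (x : UnitAddTorus d) (i j : d),
      LipschitzOnWith K
        (fun u => (Matrix.of fun a c => (1 : Matrix d d ℝ) a c + partialDeriv c (fun z => D u z a) x).adjugate i j)
        (Icc 0 T) := by
  obtain ⟨Cb, hCb⟩ := hbB 1
  obtain ⟨CD, hCD⟩ := hDB 1
  have hCb0 : 0 ≤ Cb := (norm_nonneg _).trans (hCb 0 ⟨le_rfl, hT.le⟩ 0)
  have hCD0 : 0 ≤ CD := (norm_nonneg _).trans (hCD 0 ⟨le_rfl, hT.le⟩ 0)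
  set K : ℝ := (Fintype.card d : ℝ) * ((Nat.factorial (Fintype.card d) : ℝ) * (1 + CD) ^ Fintype.card d) * Cb
    with hK
  have hK0 : 0 ≤ K := by positivity
  refine ⟨⟨K, hK0⟩, fun x i j => ?_⟩
  refine Convex.lipschitzOnWith_of_nnnorm_hasDerivWithin_le (convex_Icc 0 T)
    (fun s hs => hasDerivWithinAt_adjugate_flowJac_entry hT hbc hbs hbB hDc hDs hDB hint hdiv hs x i j)
    fun s hs => ?_
  rw [← NNReal.coe_le_coe, coe_nnnorm]
  show ‖_‖ ≤ K
  rw [Real.norm_eq_abs, abs_neg]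
  exact abs_frameRate_le hbs hCb hDs hCD hs x i j

end TorusFlow

end Literature.Analysis.ODE

end
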